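import Literature.IUT.LogVolume.DHFieldOfModuliBadRamified
import Literature.IUT.LogVolume.DifferentOrdDivisor
import Literature.IUT.LogVolume.LocalDegreeGlobalBounds
import Literature.IUT.LogVolume.DistinguishedPrimesBoundGalois
import HarnessLib

/-!
# Dupuy–Hilado (arXiv:2004.13108v2) (7.18) `ln(Diff) ≤ ln(rad|Disc(K/ℚ)|·[K:ℚ])`: what the classical
# different bound gives at every GENUINE section datum — `ln Diff ≤ ln rad|Disc(K/ℚ)| + ω(|Disc(K/ℚ)|)·ln[K:ℚ]`

PROOF-ONLY sequel of `DHBabySzpiroCorrected` / `DHFieldOfModuliBadRamified` (T. Dupuy, A. Hilado,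
arXiv:2004.13108v2 [DupuyHilado2020], UNREFEREED; held render `book:anonnd-2004-13108v2`, locators
`p.N l.M`). No new definition, no new `Prop` fact. Cited BY NAME: `SectionRamification.ofLift`, `avgDiffExp`,
`lnAvgDifferent`, `sectionRamificationOf`, `ofLift_e_eq_one_of_not_dvd`, `residueChar_liftPlace`, `sum_weight`
(this directory); the cell's classical local theory `differentOrd_lt_one_add_padicValNat_finrank` (Lenstra's
bound `d(K_w) < 1 + v_p([K_w:ℚ_p])`, `DepthConstantsBound`; Serre, *Local Fields* III §6 Prop. 13 and the
Remark following it), `differentOrd_eq_of_not_dvd` (tame case), `differentOrd_rescaledCompletion`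
(`d(K_w) = ord_w(𝔇_{K/ℤ})/e(w|p)`, `DifferentOrdDivisor`), `absRamificationIdx_rescaledCompletion`,
`finrank_rescaledCompletion_eq_localDeg`, `localDeg_eq_localDegree`,
`multiplicity_absDifferent_eq_zero_of_ramificationIdx_eq_one` (`DistinguishedPrimesBoundGalois`).

## Reading of print (p.29 l.3 and footnote 10, l.44–60)

(7.18) is derived in footnote 10 from §2.2's "`ord_p(Diff(K/ℚ_p)) = ord_p(e) + (e−1)/e`" (p.6 l.21–26; as
an upper bound this is the classical `ord_w(𝔇) ≤ e − 1 + ord_w(e)`) via the per-prime step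
"`p^{diff_p} ≤ Σ_{v|p} Pr(v)·p^{1 − 1/e(v/p) + ord_p e(v/p)} ≤ p·p^{ord_p [K:ℚ]}`" (l.45–54). The last `≤`
presumes `ord_p e(v̲/p) ≤ ord_p [K:ℚ]` at every chosen place — automatic when `K/ℚ` is Galois (`e(v̲/p) ∣
[K:ℚ]`), not implied by `K/F_mod` Galois ([IUTchI] Rmk. 3.1.5) when `F_mod/ℚ` is not. What the classical
bound yields UNCONDITIONALLY at the genuine datum `ofLift K v̲` of any section `v ↦ v̲` of finite places
over the same rational primes is recorded here (and suffices for Thm 1.0.4: sibling `DHBabySzpiroDegreeFloor`):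

* `multiplicity_differentIdeal_div_ramificationIdx_lt` — `ord_w(𝔇_{K/ℤ})/e(w|p) < 1 + v_p([K_w:ℚ_p])` for
  every finite place `w` (global spelling of Lenstra's bound; the unramified case `e(w|p) = 1 ⇒ ord_w(𝔇) = 0`
  is the tree's `multiplicity_absDifferent_eq_zero_of_ramificationIdx_eq_one`, cited BY NAME);
* `SectionRamification.diff_ofLift_lt` — `diff(v̲/p) < 1 + v_p([K_v̲:ℚ_p])`; `diff_ofLift_eq_zero_of_e_eq_one`;
  `rpow_diff_ofLift_le` — `p^{diff(v̲/p)} ≤ p·p^{v_p [K_v̲:ℚ_p]}` (`≤ p·[K:ℚ]`, `rpow_diff_ofLift_le_mul_finrank`);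
* `avgDiffExp_mul_log_ofLift_le` — per prime, `diff_p·ln p ≤ ln p + ln[K:ℚ]` if `p ∣ Disc(K/ℚ)`, `= 0`
  otherwise (Dedekind: `p ∤ Disc ⇒` every `e(v̲/p) = 1`, `ofLift_e_eq_one_of_not_dvd`);
* `lnAvgDifferent_ofLift_le` — **`ln Diff(V̲/ℚ) ≤ ln rad|Disc(K/ℚ)| + ω(|Disc(K/ℚ)|)·ln[K:ℚ]`** for every
  finite set `T` of primes (`ω` = number of prime divisors): (7.18) with its `ln[K:ℚ]` weighted by `ω`;
  `lnAvgDifferent_sectionRamificationOf_le` — the same for Def. 1.0.2's datum OF an initial Θ-datum `D`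
  (replaces the typed hypothesis `h18` of `babySzpiroThm_of_ineq718`).

HONEST FRAMING: everything here is classical (Dedekind–Hensel different bounds read through the cell's
completions); nothing bears on [IUTchIII] Cor. 3.12 [claim: Mochizuki2012, status: disputed] or on Claim 5.0.1
[claim: DupuyHilado2020, status: under-review]. The printed (7.18) itself is not asserted. Typed ≠ proved ≠
endorsed; no side is taken on any author; no abc claim.
-/

noncomputable section

namespace Literature.IUT.LogVolume

open NumberField IsDedekindDomain Finset Literature.NumberTheory.NumberFields

/-! ## Classical input: the different bound in global spelling -/
section Classical

variable (K : Type) [Field K] [NumberField K]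


/-- **`ord_w(𝔇_{K/ℤ})/e(w|p) < 1 + v_p([K_w:ℚ_p])`** for every finite place `w` of a number field `K`
(`p = char κ(w)`, `[K_w:ℚ_p] = e_w f_w` = `localDegree K w`): Lenstra's bound
`differentOrd_lt_one_add_padicValNat_finrank` for the completion `K_w` read through the local–global bridge
`differentOrd_rescaledCompletion`. This is §2.2's "`ord_p(Diff(K/ℚ_p)) = ord_p(e) + (e−1)/e`" (p.6 l.21–26)
in the direction footnote 10 uses it (`v_p(e) ≤ v_p(e f)`).
[cite: SerreLocalFields1979, Ch. III §6 Prop. 13 and Remark] [cite: DupuyHilado2020, §2.2 p.6 l.4–26; footnote 10 p.29 l.44–54] -/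
theorem multiplicity_differentIdeal_div_ramificationIdx_lt (w : HeightOneSpectrum (𝓞 K)) :
    (multiplicity w.asIdeal (differentIdeal ℤ (𝓞 K)) : ℝ) / (w.asIdeal.ramificationIdx ℤ : ℝ) <
      1 + padicValNat (residueChar K w) (localDegree K w) := by
  haveI : Fact (residueChar K w).Prime := ⟨residueChar_prime K w⟩
  have hw := natCast_residueChar_mem K w
  rw [← differentOrd_rescaledCompletion K (residueChar K w) w hw, ← localDeg_eq_localDegree,
    ← finrank_rescaledCompletion_eq_localDeg K (residueChar K w) w hw]
  exact differentOrd_lt_one_add_padicValNat_finrank (residueChar K w) _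

end Classical

namespace ExplicitSzpiro

variable {F₀ : Type} [Field F₀] [NumberField F₀]

/-- `diff_p·ln p = ln(Σ_{v|p} Pr(v)·p^{diff(v̲/p)})` (`diff_p = log_p E(p^{diff(v/p)})`, (1.4) p.3 l.17; (7.7) p.25
l.1–3), for a prime `p`. [cite: DupuyHilado2020, (1.4) p.3 l.11–17] -/
theorem SectionRamification.avgDiffExp_mul_log (R : SectionRamification F₀) (p : ℕ) [Fact p.Prime] :
    R.avgDiffExp p * Real.log p =
      Real.log (∑ v ∈ placesOver F₀ p, (p : ℝ) ^ R.diff v * weight F₀ v) := by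
  have hp : Real.log p ≠ 0 :=
    (Real.log_pos (by exact_mod_cast (Fact.out : p.Prime).one_lt)).ne'
  unfold SectionRamification.avgDiffExp
  rw [Real.logb, div_mul_cancel₀ _ hp]

/-- `1 ≤ Σ_{v|p} Pr(v)·p^{diff(v̲/p)}` (each `p^{diff} ≥ 1`, `Σ_v Pr(v) = 1`). [cite: DupuyHilado2020, (1.4) p.3 l.11–17] -/
theorem SectionRamification.one_le_sum_rpow_diff_mul_weight (R : SectionRamification F₀) (p : ℕ) [Fact p.Prime] :
    1 ≤ ∑ v ∈ placesOver F₀ p, (p : ℝ) ^ R.diff v * weight F₀ v := by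
  calc (1 : ℝ) = ∑ v ∈ placesOver F₀ p, weight F₀ v := (sum_weight p).symm
    _ ≤ ∑ v ∈ placesOver F₀ p, (p : ℝ) ^ R.diff v * weight F₀ v :=
        Finset.sum_le_sum fun v _ => le_mul_of_one_le_left (weight_nonneg F₀ v)
          (Real.one_le_rpow (by exact_mod_cast (Fact.out : p.Prime).one_lt.le) (R.diff_nonneg v))

/-! ## The genuine datum `ofLift K v̲`: the different exponents against `[K:ℚ]` and `Disc(K/ℚ)` -/
section OfLift

variable (K : Type) [Field K] [NumberField K] (lift : HeightOneSpectrum (𝓞 F₀) → HeightOneSpectrum (𝓞 K))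

omit [NumberField F₀] in
/-- `diff(v̲/p) = ord_{v̲}(𝔇_{K/ℤ})/e(v̲|p)` with Mathlib's `Ideal.ramificationIdx` over `ℤ` (the datum's `ramIdx`).
[cite: DupuyHilado2020, Def. 1.0.2 p.3 l.17–19] -/
theorem SectionRamification.diff_ofLift_eq (v : HeightOneSpectrum (𝓞 F₀)) :
    (SectionRamification.ofLift K lift).diff v =
      (multiplicity (lift v).asIdeal (differentIdeal ℤ (𝓞 K)) : ℝ) /
        ((lift v).asIdeal.ramificationIdx ℤ : ℝ) := by
  show (multiplicity (lift v).asIdeal (differentIdeal ℤ (𝓞 K)) : ℝ) / (ramIdx K (lift v) : ℝ) = _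
  rw [ramIdx, Ideal.ramificationIdx'_eq_ramificationIdx (Ideal.span {(residueChar K (lift v) : ℤ)})
    (lift v).asIdeal (by simp [(residueChar_prime K (lift v)).ne_zero])]

omit [NumberField F₀] in
/-- **`diff(v̲/p) < 1 + v_p([K_v̲:ℚ_p])`** at the genuine datum (Lenstra / Hensel; footnote 10's
"`pdiff(v/p) ≤ 1 − 1/e(v/p) + ord_p e(v/p)`" p.29 l.49–54 in the form `v_p(e) ≤ v_p(e f)`).
[cite: DupuyHilado2020, footnote 10 p.29 l.44–54] [cite: SerreLocalFields1979, Ch. III §6 Prop. 13 and Remark] -/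
theorem SectionRamification.diff_ofLift_lt (v : HeightOneSpectrum (𝓞 F₀)) :
    (SectionRamification.ofLift K lift).diff v <
      1 + padicValNat (residueChar K (lift v)) (localDegree K (lift v)) := by
  rw [SectionRamification.diff_ofLift_eq]
  exact multiplicity_differentIdeal_div_ramificationIdx_lt K (lift v)

omit [NumberField F₀] in
/-- `e(v̲/p) = 1 ⇒ diff(v̲/p) = 0` at the genuine datum (`multiplicity_absDifferent_eq_zero_of_ramificationIdx_eq_one`).
[cite: NeukirchANT1999, Ch. III (2.6)] -/
theorem SectionRamification.diff_ofLift_eq_zero_of_e_eq_one (v : HeightOneSpectrum (𝓞 F₀))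
    (h : (SectionRamification.ofLift K lift).e v = 1) : (SectionRamification.ofLift K lift).diff v = 0 := by
  have h' : (lift v).asIdeal.ramificationIdx ℤ = 1 := by
    rw [← Ideal.ramificationIdx'_eq_ramificationIdx (Ideal.span {(residueChar K (lift v) : ℤ)})
      (lift v).asIdeal (by simp [(residueChar_prime K (lift v)).ne_zero])]
    exact h
  rw [SectionRamification.diff_ofLift_eq,
    multiplicity_absDifferent_eq_zero_of_ramificationIdx_eq_one (lift v) h']
  simp

/-- **`p^{diff(v̲/p)} ≤ p·p^{v_p([K_v̲:ℚ_p])}`** for `v ∈ V(F₀)_p` and a section over the same rational primes —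
the valid part of footnote 10's per-prime step (p.29 l.45–54). [cite: DupuyHilado2020, footnote 10 p.29 l.44–54] -/
theorem SectionRamification.rpow_diff_ofLift_le (hlift : ∀ v, residueChar K (lift v) = residueChar F₀ v)
    (p : ℕ) [Fact p.Prime] (v : HeightOneSpectrum (𝓞 F₀)) (hv : v ∈ placesOver F₀ p) :
    (p : ℝ) ^ (SectionRamification.ofLift K lift).diff v ≤
      p * ((p ^ padicValNat p (localDegree K (lift v)) : ℕ) : ℝ) := by
  have hp : residueChar K (lift v) = p := by
    rw [hlift v]; exact (mem_placesOver_iff_residueChar v).mp hv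
  have hlt := SectionRamification.diff_ofLift_lt K lift v
  rw [hp] at hlt
  have hp1 : (1 : ℝ) ≤ p := by exact_mod_cast (Fact.out : p.Prime).one_lt.le
  have hp0 : (0 : ℝ) < p := by positivity
  calc (p : ℝ) ^ (SectionRamification.ofLift K lift).diff v
      ≤ (p : ℝ) ^ ((1 : ℝ) + ((padicValNat p (localDegree K (lift v)) : ℕ) : ℝ)) :=
        Real.rpow_le_rpow_of_exponent_le hp1 hlt.le
    _ = p * ((p ^ padicValNat p (localDegree K (lift v)) : ℕ) : ℝ) := by
        rw [Real.rpow_add hp0, Real.rpow_one, Real.rpow_natCast]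
        push_cast
        ring

/-- … hence `p^{diff(v̲/p)} ≤ p·[K_v̲:ℚ_p] ≤ p·[K:ℚ]` (`p^{v_p n} ∣ n`, `n_v̲ ≤ [K:ℚ]`).
[cite: DupuyHilado2020, footnote 10 p.29 l.44–54] -/
theorem SectionRamification.rpow_diff_ofLift_le_mul_finrank
    (hlift : ∀ v, residueChar K (lift v) = residueChar F₀ v)
    (p : ℕ) [Fact p.Prime] (v : HeightOneSpectrum (𝓞 F₀)) (hv : v ∈ placesOver F₀ p) :
    (p : ℝ) ^ (SectionRamification.ofLift K lift).diff v ≤ p * Module.finrank ℚ K := by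
  have h1 := SectionRamification.rpow_diff_ofLift_le K lift hlift p v hv
  have h2 : p ^ padicValNat p (localDegree K (lift v)) ≤ localDegree K (lift v) :=
    Nat.le_of_dvd (localDegree_pos K (lift v)) pow_padicValNat_dvd
  have h3 : localDegree K (lift v) ≤ Module.finrank ℚ K := by
    rw [← localDeg_eq_localDegree]; exact localDeg_le_finrank_rat K (lift v)
  have h4 : ((p ^ padicValNat p (localDegree K (lift v)) : ℕ) : ℝ) ≤ Module.finrank ℚ K := by
    exact_mod_cast h2.trans h3
  have hp0 : (0 : ℝ) ≤ p := by positivity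
  exact h1.trans (mul_le_mul_of_nonneg_left h4 hp0)

/-- `p ∤ Disc(K/ℚ) ⇒ Σ_{v|p} Pr(v)·p^{diff(v̲/p)} = 1` (every `e(v̲/p) = 1`, Dedekind, `ofLift_e_eq_one_of_not_dvd`).
[cite: DupuyHilado2020, footnote 10 p.29 l.44–60] -/
theorem SectionRamification.sum_rpow_diff_mul_weight_ofLift_eq_one_of_not_dvd
    (hlift : ∀ v, residueChar K (lift v) = residueChar F₀ v)
    (p : ℕ) [Fact p.Prime] (hD : ¬ p ∣ (NumberField.discr K).natAbs) :
    ∑ v ∈ placesOver F₀ p, (p : ℝ) ^ (SectionRamification.ofLift K lift).diff v * weight F₀ v = 1 := by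
  have hall := ofLift_e_eq_one_of_not_dvd K lift hlift p hD
  rw [Finset.sum_congr rfl fun v hv => by
    rw [SectionRamification.diff_ofLift_eq_zero_of_e_eq_one K lift v (hall v hv), Real.rpow_zero, one_mul]]
  exact sum_weight p

/-- `Σ_{v|p} Pr(v)·p^{diff(v̲/p)} ≤ p·[K:ℚ]` at the genuine datum. [cite: DupuyHilado2020, footnote 10 p.29 l.44–60] -/
theorem SectionRamification.sum_rpow_diff_mul_weight_ofLift_le
    (hlift : ∀ v, residueChar K (lift v) = residueChar F₀ v) (p : ℕ) [Fact p.Prime] :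
    ∑ v ∈ placesOver F₀ p, (p : ℝ) ^ (SectionRamification.ofLift K lift).diff v * weight F₀ v ≤
      p * Module.finrank ℚ K := by
  calc ∑ v ∈ placesOver F₀ p, (p : ℝ) ^ (SectionRamification.ofLift K lift).diff v * weight F₀ v
      ≤ ∑ v ∈ placesOver F₀ p, ((p : ℝ) * Module.finrank ℚ K) * weight F₀ v :=
        Finset.sum_le_sum fun v hv => mul_le_mul_of_nonneg_right
          (SectionRamification.rpow_diff_ofLift_le_mul_finrank K lift hlift p v hv) (weight_nonneg F₀ v)
    _ = p * Module.finrank ℚ K := by rw [← Finset.mul_sum, sum_weight, mul_one]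

/-- **Per prime: `diff_p·ln p ≤ ln p + ln[K:ℚ]` if `p ∣ Disc(K/ℚ)`, `= 0` otherwise** (genuine datum).
[cite: DupuyHilado2020, footnote 10 p.29 l.44–60] -/
theorem SectionRamification.avgDiffExp_mul_log_ofLift_le
    (hlift : ∀ v, residueChar K (lift v) = residueChar F₀ v) (p : ℕ) [Fact p.Prime] :
    (SectionRamification.ofLift K lift).avgDiffExp p * Real.log p ≤
      if p ∣ (NumberField.discr K).natAbs then Real.log p + Real.log (Module.finrank ℚ K) else 0 := by
  rw [SectionRamification.avgDiffExp_mul_log]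
  split_ifs with hD
  · have h1 := SectionRamification.one_le_sum_rpow_diff_mul_weight (SectionRamification.ofLift K lift) p
    have hp0 : (0 : ℝ) < p := by exact_mod_cast (Fact.out : p.Prime).pos
    have hd0 : (0 : ℝ) < Module.finrank ℚ K := by exact_mod_cast Module.finrank_pos
    calc Real.log (∑ v ∈ placesOver F₀ p, (p : ℝ) ^ (SectionRamification.ofLift K lift).diff v * weight F₀ v)
        ≤ Real.log ((p : ℝ) * Module.finrank ℚ K) :=
          Real.log_le_log (by linarith) (SectionRamification.sum_rpow_diff_mul_weight_ofLift_le K lift hlift p)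
      _ = Real.log p + Real.log (Module.finrank ℚ K) := Real.log_mul hp0.ne' hd0.ne'
  · rw [SectionRamification.sum_rpow_diff_mul_weight_ofLift_eq_one_of_not_dvd K lift hlift p hD, Real.log_one]

/-- Bookkeeping: a sum over a set `T` of primes of terms supported on the prime divisors of `D ≠ 0` and
dominated there by `c ≥ 0` is at most `Σ_{p | D} c(p)`. [folklore] -/
private theorem sum_primes_le_sum_primeFactors (T : Finset ℕ) (hT : ∀ p ∈ T, p.Prime) (D : ℕ)
    (hD : D ≠ 0) (f c : ℕ → ℝ) (hc : ∀ p, 0 ≤ c p) (h : ∀ p ∈ T, f p ≤ if p ∣ D then c p else 0) :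
    ∑ p ∈ T, f p ≤ ∑ p ∈ D.primeFactors, c p := by
  calc ∑ p ∈ T, f p ≤ ∑ p ∈ T, (if p ∣ D then c p else 0) := Finset.sum_le_sum h
    _ = ∑ p ∈ T.filter (fun p => p ∣ D), c p := (Finset.sum_filter _ _).symm
    _ ≤ ∑ p ∈ D.primeFactors, c p :=
        Finset.sum_le_sum_of_subset_of_nonneg (fun p hp => by
          rw [Finset.mem_filter] at hp
          exact Nat.mem_primeFactors.mpr ⟨hT p hp.1, hp.2, hD⟩) (fun p _ _ => hc p)

/-- **(7.18), the form the classical different bound gives at every genuine datum, PROVED**: for a finite set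
`T` of primes, `ln Diff(V̲/ℚ) ≤ ln rad|Disc(K/ℚ)| + ω(|Disc(K/ℚ)|)·ln[K:ℚ]` (`ω` = number of prime divisors).
Print's (7.18) "`ln(Diff) ≤ ln(rad|Disc(K/ℚ)|·[K:ℚ])`" (p.29 l.3) has `ln[K:ℚ]` once; its footnote-10 step
`p^{ord_p e(v/p)} ≤ p^{ord_p [K:ℚ]}` (l.53–54) presumes `K/ℚ` Galois (sibling file `DHAvgDifferentBoundGalois`).
[cite: DupuyHilado2020, (7.18) p.29 l.3; footnote 10 p.29 l.44–60] -/
theorem SectionRamification.lnAvgDifferent_ofLift_le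
    (hlift : ∀ v, residueChar K (lift v) = residueChar F₀ v) (T : Finset ℕ) (hT : ∀ p ∈ T, p.Prime) :
    (SectionRamification.ofLift K lift).lnAvgDifferent T ≤
      Real.log (∏ p ∈ (NumberField.discr K).natAbs.primeFactors, (p : ℝ)) +
        ((NumberField.discr K).natAbs.primeFactors.card : ℝ) * Real.log (Module.finrank ℚ K) := by
  have hD0 : (NumberField.discr K).natAbs ≠ 0 := Int.natAbs_ne_zero.mpr (NumberField.discr_ne_zero K)
  have h := sum_primes_le_sum_primeFactors T hT _ hD0
    (fun p => (SectionRamification.ofLift K lift).avgDiffExp p * Real.log p)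
    (fun p => Real.log p + Real.log (Module.finrank ℚ K))
    (fun p => add_nonneg (Real.log_natCast_nonneg p) (Real.log_natCast_nonneg _)) fun p hp => by
      haveI : Fact p.Prime := ⟨hT p hp⟩
      exact SectionRamification.avgDiffExp_mul_log_ofLift_le K lift hlift p
  have hrad : ∑ p ∈ (NumberField.discr K).natAbs.primeFactors, Real.log p =
      Real.log (∏ p ∈ (NumberField.discr K).natAbs.primeFactors, (p : ℝ)) := by
    rw [Real.log_prod]
    exact fun p hp => by exact_mod_cast (Nat.prime_of_mem_primeFactors hp).ne_zero
  unfold SectionRamification.lnAvgDifferent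
  rw [Finset.sum_add_distrib, Finset.sum_const, nsmul_eq_mul, hrad] at h
  exact h

end OfLift

/-! ## At an initial Θ-datum `D`: (7.18)♯ for `sectionRamificationOf D` -/
section ThetaData

open Literature.IUT.HodgeTheaters

variable {F K Fbar : Type} [Field F] [NumberField F] [Field K] [NumberField K] [Algebra F K]
  [Field Fbar] [Algebra F Fbar] [Algebra K Fbar] [DecidableEq F] [DecidableEq Fbar]
  {E : WeierstrassCurve F} [E.IsElliptic] {l : ℕ}
  {Pb : BadPlacePredicates K} (D : InitialThetaData F K Fbar E l Pb)

omit [DecidableEq F] [DecidableEq Fbar] in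
/-- **(7.18)♯ at `D`**: for Def. 1.0.2's datum OF the initial Θ-datum (`sectionRamificationOf D`, section
`liftPlace D`) and any finite set `T` of primes, `ln Diff ≤ ln rad|Disc(K/ℚ)| + ω(|Disc(K/ℚ)|)·ln[K:ℚ]` —
PROVED; replaces the typed hypothesis `h18` of `babySzpiroThm_of_ineq718`.
[cite: DupuyHilado2020, (7.18) p.29 l.3; footnote 10 p.29 l.44–60] -/
theorem lnAvgDifferent_sectionRamificationOf_le (T : Finset ℕ) (hT : ∀ p ∈ T, p.Prime) :
    (sectionRamificationOf D).lnAvgDifferent T ≤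
      Real.log (∏ p ∈ (NumberField.discr K).natAbs.primeFactors, (p : ℝ)) +
        ((NumberField.discr K).natAbs.primeFactors.card : ℝ) * Real.log (Module.finrank ℚ K) :=
  SectionRamification.lnAvgDifferent_ofLift_le K (ThetaData.liftPlace D) (residueChar_liftPlace D) T hT

end ThetaData

end ExplicitSzpiro

end Literature.IUT.LogVolume

end
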